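import Mathlib.Analysis.SpecialFunctions.Pow.Real
import Mathlib.Analysis.SpecialFunctions.Integrals.Basic
import Mathlib.Analysis.SpecialFunctions.ImproperIntegrals
import Mathlib.MeasureTheory.Integral.Pi
import Literature.NumberTheory.Transcendental.SemialgebraicVolumeComputable
import HarnessLib

/-!
# Polynomial tail decay for finite-volume semialgebraic down-sets

The two resolution-free routes to Yoshinaga's theorem recorded in the tree
(`FiniteVolumeComputable.lean`: real periods are computable reals; `FiniteVolumeElementary.lean`:
real periods are elementary reals [Yoshinaga 2008, arXiv:0805.0349, Thm. 18]) reduce everything to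
one input, taken there as an explicit hypothesis: the **tail estimate**
`vol(E ∖ B(0, R)) ≤ C R^{-a}` (`a > 0`) for `ℚ`-semialgebraic sets `E` of finite volume — for
general `E` a theorem of tame integration theory (the tail is a constructible function of `R`
[Cluckers–Miller 2011, Thm. 1.3] tending to `0`, hence polynomially small [ibid., Prop. 1.5]),
resting on the Lion–Rolin preparation theorem.

This file proves the tail estimate, by an elementary argument, for the class of sets to which every
finite-volume semialgebraic set is reduced by "grounding" its fibres (replacing each
one-dimensional fibre by the interval `(0, its length)`, which preserves volume and
semialgebraicity, `SemialgebraicGrounding.lean`): the **coordinatewise down-sets of the open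
positive orthant** (`x ∈ D`, `0 < yᵢ ≤ xᵢ ∀ i` `⇒ y ∈ D`).

* **Boxes.** For `x ∈ D` the box `∏ (0, xᵢ]` lies in `D`, so `∏ xᵢ ≤ vol D`; let
  `M(r) = sup {∏ xᵢ | x ∈ D, max xᵢ ≥ r}` (the box-volume profile, antitone).
* **`M → 0`** (`exists_M_lt`): otherwise there are `x⁽ʲ⁾ ∈ D` with `∏ xᵢ⁽ʲ⁾ > δ/2` and largest
  coordinates `s_{j+1} > 2 s_j`; the sets `box(x⁽ʲ⁾) ∖ (0, s_j/2]^{n+1} ⊆ D` are pairwise disjoint of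
  volume `≥ δ/4`, contradicting `vol D < ∞`.
* **`M(r) ≤ C r^{-α}`** (`exists_prod_le_mul_rpow`): the plane set
  `P = {(r, z) | ∃ x ∈ D, r ≤ max xᵢ, z ≤ ∏ xᵢ}` is `ℚ`-semialgebraic (Tarski–Seidenberg), so its
  frontier lies in the zero set of a nonzero polynomial `Q(r, z)`
  (`SemialgVolume.exists_ne_zero_frontier_subset`), and `(r, M(r)) ∈ ∂P` whenever `M(r) > 0`. The
  **two-term decay lemma** `exists_le_rpow_neg_of_eval_eq_zero` — an elementary substitute for the
  Puiseux expansion at infinity — then gives the power decay: at a zero `(r, y)` of `Q` with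
  `r, y > 0` the largest two terms `|c| r^a y^b`, `|c'| r^{a'} y^{b'}` are comparable, which for
  `b ≠ b'` pins `y` between constant multiples of `r^q`, `q = (a'-a)/(b-b')`, and for `b = b'`
  bounds `r`; slopes `q ≥ 0` are excluded for large `r` because `M → 0`, and the finitely many
  negative slopes give `α`.
* **Tail** (`exists_volume_diff_ball_le`): a point of `D ∖ B(0, R)` has `2^k R ≤ max xᵢ < 2^{k+1} R`
  for some `k`, hence lies in `{y ∈ (0, 2^{k+1}R]^{n+1} | ∏ yⱼ ≤ C (2^k R)^{-α}}`, of volume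
  `≤ K₁ (2^k R)^{-α/2}` by the Markov-power bound `1 ≤ (K/∏ yⱼ)^θ`, `θ = (n+1+α/2)/(n+1+α)`, and
  Fubini for the product `∏ yⱼ^{-θ}` (`volume_prodLe_le`); summing the geometric series,
  `vol(D ∖ B(0, R)) ≤ K₁ (1 - 2^{-α/2})⁻¹ R^{-α/2}`.

## Main statements

* `DownSetTail.exists_le_rpow_neg_of_eval_eq_zero` — two-term decay lemma.
* `DownSetTail.exists_M_lt` — the box-volume profile of a finite-volume down-set tends to `0`.
* `DownSetTail.exists_prod_le_mul_rpow` — `∏ xᵢ ≤ C (max xᵢ)^{-α}` on a `ℚ`-semialgebraic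
  finite-volume down-set.
* `DownSetTail.exists_volume_diff_ball_le` — **polynomial tail decay** for `ℚ`-semialgebraic
  finite-volume down-sets of the open positive orthant, in the shape of the hypothesis of
  `SemialgVolume.isComputableReal_volume_of_tailDecay` and
  `Yoshinaga.isElementaryReal_volume_of_tailDecay`.

## References

* M. Yoshinaga, *Periods and elementary real numbers*, arXiv:0805.0349 (2008), §3.1 Thm. 18, §3.2
  Lemma 24 (the bounded reduction, via Hironaka's rectilinearization, which this route avoids).
* R. Cluckers, D. J. Miller, *Stability under integration of sums of products of real globally
  subanalytic functions and their logarithms*, Duke Math. J. 156 (2011), Thm. 1.3, Prop. 1.5 (the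
  general tail estimate; not used).
* J. Bochnak, M. Coste, M.-F. Roy, *Real Algebraic Geometry*, Springer (1998), Thm. 2.2.1
  (Tarski–Seidenberg), §2.9 (a semialgebraic function satisfies a polynomial relation).

## Design notes

* Only bookkeeping definitions are introduced (`term`, `lam`, `expE`, `expF`, `slope`, `Rstar`,
  `hiConst`, `loConst`, `msup`, `box`, `boxVols`, `M`, `radii`, `planeSet`); no named facts. The down-set
  hypotheses are kept as explicit binders (`hpos`, `hdown`), the form produced by
  `SemialgebraicGrounding.lean`.
* Dimension is `n + 1` throughout (`max` of the coordinates needs a coordinate); the tail statement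
  uses sup-norm balls `Metric.ball 0 R` of `Fin (n + 1) → ℝ` and real powers `R ^ (-a)`, verbatim
  the hypothesis shape of `FiniteVolumeComputable.lean` / `FiniteVolumeElementary.lean`.
-/

noncomputable section

open MeasureTheory Set Metric Filter Topology
open scoped ENNReal

namespace Literature.NumberTheory.Transcendental

namespace DownSetTail

/-! ### Two dominant terms of a vanishing polynomial -/

/-- The absolute value of the `d`-th term of `Q` at the point `(r, y)`. [folklore] -/
def term (Q : MvPolynomial (Fin 2) ℝ) (r y : ℝ) (d : Fin 2 →₀ ℕ) : ℝ :=
  |Q.coeff d| * (r ^ (d 0) * y ^ (d 1))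

/-- Evaluation of a bivariate polynomial as the sum of its terms. [folklore] -/
theorem eval_eq_sum (Q : MvPolynomial (Fin 2) ℝ) (r y : ℝ) :
    MvPolynomial.eval ![r, y] Q = ∑ d ∈ Q.support, Q.coeff d * (r ^ (d 0) * y ^ (d 1)) := by
  rw [MvPolynomial.eval_eq']
  refine Finset.sum_congr rfl fun d _ => ?_
  rw [Fin.prod_univ_two]
  rfl

/-- Terms of the support are positive at points with positive coordinates. [folklore] -/
theorem term_pos {Q : MvPolynomial (Fin 2) ℝ} {r y : ℝ} (hr : 0 < r) (hy : 0 < y)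
    {d : Fin 2 →₀ ℕ} (hd : d ∈ Q.support) : 0 < term Q r y d := by
  unfold term
  have hc : Q.coeff d ≠ 0 := MvPolynomial.mem_support_iff.1 hd
  positivity

/-- **Two dominant terms.** If a nonzero polynomial `Q(r, y)` vanishes at a point with `r, y > 0`,
then two distinct terms of `Q` are comparable there: the largest term `T_d` and the second largest
`T_{d'}` satisfy `T_{d'} ≤ T_d ≤ (n - 1) T_{d'}`, `n` the number of terms. [folklore] -/
theorem exists_dominant_pair {Q : MvPolynomial (Fin 2) ℝ} {r y : ℝ} (hr : 0 < r) (hy : 0 < y)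
    (h0 : MvPolynomial.eval ![r, y] Q = 0) (hQ : Q ≠ 0) :
    ∃ d ∈ Q.support, ∃ d' ∈ Q.support, d ≠ d' ∧ term Q r y d' ≤ term Q r y d ∧
      term Q r y d ≤ ((Q.support.card : ℝ) - 1) * term Q r y d' := by
  classical
  set s := Q.support with hs
  have hsne : s.Nonempty := by
    rw [Finset.nonempty_iff_ne_empty, hs, Ne, MvPolynomial.support_eq_empty]
    exact hQ
  obtain ⟨d, hd, hdmax⟩ := Finset.exists_max_image s (term Q r y) hsne
  -- the support has a second element
  have hne2 : (s.erase d).Nonempty := by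
    rw [Finset.nonempty_iff_ne_empty]
    intro he
    have hsd : s = {d} := by
      rw [← Finset.insert_erase hd, he]
      rfl
    have := eval_eq_sum Q r y
    rw [h0, ← hs, hsd, Finset.sum_singleton] at this
    have hpos := term_pos (Q := Q) hr hy hd
    unfold term at hpos
    have hc : Q.coeff d ≠ 0 := MvPolynomial.mem_support_iff.1 hd
    have hm : 0 < r ^ (d 0) * y ^ (d 1) := by positivity
    exact (mul_ne_zero hc hm.ne') this.symm
  obtain ⟨d', hd', hd'max⟩ := Finset.exists_max_image (s.erase d) (term Q r y) hne2
  have hd's : d' ∈ s := Finset.mem_of_mem_erase hd'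
  refine ⟨d, hd, d', hd's, (Finset.ne_of_mem_erase hd').symm, hdmax d' hd's, ?_⟩
  -- `T_d = |Σ_{e ≠ d} c_e m_e| ≤ Σ_{e ≠ d} T_e ≤ (n-1) T_{d'}`
  have hsum := eval_eq_sum Q r y
  rw [h0, ← hs, ← Finset.add_sum_erase s _ hd] at hsum
  have h1 : term Q r y d = |∑ e ∈ s.erase d, Q.coeff e * (r ^ (e 0) * y ^ (e 1))| := by
    have : Q.coeff d * (r ^ (d 0) * y ^ (d 1)) =
        -∑ e ∈ s.erase d, Q.coeff e * (r ^ (e 0) * y ^ (e 1)) := by linarith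
    unfold term
    rw [← abs_of_pos (show 0 < r ^ (d 0) * y ^ (d 1) by positivity), ← abs_mul, this, abs_neg]
  have h2 : |∑ e ∈ s.erase d, Q.coeff e * (r ^ (e 0) * y ^ (e 1))| ≤
      ∑ e ∈ s.erase d, term Q r y e := by
    refine (Finset.abs_sum_le_sum_abs _ _).trans (le_of_eq (Finset.sum_congr rfl fun e _ => ?_))
    unfold term
    rw [abs_mul, abs_of_pos (show 0 < r ^ (e 0) * y ^ (e 1) by positivity)]
  have h3 : ∑ e ∈ s.erase d, term Q r y e ≤ ((s.erase d).card : ℝ) * term Q r y d' := by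
    have := Finset.sum_le_card_nsmul (s.erase d) (term Q r y) _ hd'max
    rwa [nsmul_eq_mul] at this
  have h4 : ((s.erase d).card : ℝ) = (s.card : ℝ) - 1 := by
    rw [Finset.card_erase_of_mem hd, Nat.cast_sub (Finset.card_pos.2 hsne), Nat.cast_one]
  calc term Q r y d ≤ ∑ e ∈ s.erase d, term Q r y e := h1 ▸ h2
    _ ≤ ((s.card : ℝ) - 1) * term Q r y d' := h4 ▸ h3

/-! ### Bounds extracted from a dominant pair -/

/-- Ratio of the coefficients of an ordered pair of terms. [folklore] -/
def lam (Q : MvPolynomial (Fin 2) ℝ) (π : (Fin 2 →₀ ℕ) × (Fin 2 →₀ ℕ)) : ℝ :=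
  |Q.coeff π.2| / |Q.coeff π.1|

/-- Difference of the `y`-exponents of an ordered pair of terms. [folklore] -/
def expE (π : (Fin 2 →₀ ℕ) × (Fin 2 →₀ ℕ)) : ℝ := (π.1 1 : ℝ) - (π.2 1 : ℝ)

/-- Difference of the `r`-exponents of an ordered pair of terms. [folklore] -/
def expF (π : (Fin 2 →₀ ℕ) × (Fin 2 →₀ ℕ)) : ℝ := (π.2 0 : ℝ) - (π.1 0 : ℝ)

/-- The slope `(a' - a)/(b - b')` of an ordered pair of terms `c r^a y^b`, `c' r^{a'} y^{b'}` (a slope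
of the Newton polygon when the pair is dominant). [folklore] -/
def slope (π : (Fin 2 →₀ ℕ) × (Fin 2 →₀ ℕ)) : ℝ := expF π * (expE π)⁻¹

/-- Threshold beyond which two terms with the same `y`-exponent cannot be comparable. [folklore] -/
def Rstar (Q : MvPolynomial (Fin 2) ℝ) (π : (Fin 2 →₀ ℕ) × (Fin 2 →₀ ℕ)) : ℝ :=
  max (((Q.support.card : ℝ) - 1) * lam Q π) (lam Q π)⁻¹

/-- Upper constant of a pair. [folklore] -/
def hiConst (Q : MvPolynomial (Fin 2) ℝ) (π : (Fin 2 →₀ ℕ) × (Fin 2 →₀ ℕ)) : ℝ :=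
  max (lam Q π ^ (expE π)⁻¹) ((((Q.support.card : ℝ) - 1) * lam Q π) ^ (expE π)⁻¹)

/-- Lower constant of a pair. [folklore] -/
def loConst (Q : MvPolynomial (Fin 2) ℝ) (π : (Fin 2 →₀ ℕ) × (Fin 2 →₀ ℕ)) : ℝ :=
  min (lam Q π ^ (expE π)⁻¹) ((((Q.support.card : ℝ) - 1) * lam Q π) ^ (expE π)⁻¹)

/-- The coefficient ratio of a pair of terms of the support is positive. [folklore] -/
theorem lam_pos {Q : MvPolynomial (Fin 2) ℝ} {π : (Fin 2 →₀ ℕ) × (Fin 2 →₀ ℕ)}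
    (h1 : π.1 ∈ Q.support) (h2 : π.2 ∈ Q.support) : 0 < lam Q π := by
  unfold lam
  have hc1 : Q.coeff π.1 ≠ 0 := MvPolynomial.mem_support_iff.1 h1
  have hc2 : Q.coeff π.2 ≠ 0 := MvPolynomial.mem_support_iff.1 h2
  positivity

/-- The threshold `R*` of a pair is positive. [folklore] -/
theorem Rstar_pos {Q : MvPolynomial (Fin 2) ℝ} {π : (Fin 2 →₀ ℕ) × (Fin 2 →₀ ℕ)}
    (h1 : π.1 ∈ Q.support) (h2 : π.2 ∈ Q.support) : 0 < Rstar Q π :=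
  lt_max_of_lt_right (inv_pos.2 (lam_pos h1 h2))

/-- The lower constant of a pair is positive. [folklore] -/
theorem loConst_pos {Q : MvPolynomial (Fin 2) ℝ} {π : (Fin 2 →₀ ℕ) × (Fin 2 →₀ ℕ)}
    (h1 : π.1 ∈ Q.support) (h2 : π.2 ∈ Q.support) (hn : 0 < (Q.support.card : ℝ) - 1) :
    0 < loConst Q π := by
  unfold loConst
  have := lam_pos h1 h2
  exact lt_min (Real.rpow_pos_of_pos this _) (Real.rpow_pos_of_pos (mul_pos hn this) _)

/-- The upper constant of a pair is positive. [folklore] -/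
theorem hiConst_pos {Q : MvPolynomial (Fin 2) ℝ} {π : (Fin 2 →₀ ℕ) × (Fin 2 →₀ ℕ)}
    (h1 : π.1 ∈ Q.support) (h2 : π.2 ∈ Q.support) : 0 < hiConst Q π :=
  lt_max_of_lt_left (Real.rpow_pos_of_pos (lam_pos h1 h2) _)

/-- A support with two distinct elements has `n - 1 > 0`. [folklore] -/
theorem one_lt_card_of_ne {Q : MvPolynomial (Fin 2) ℝ} {d d' : Fin 2 →₀ ℕ} (hd : d ∈ Q.support)
    (hd' : d' ∈ Q.support) (hne : d ≠ d') : 0 < (Q.support.card : ℝ) - 1 := by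
  have : 1 < Q.support.card := Finset.one_lt_card.2 ⟨d, hd, d', hd', hne⟩
  have : (1 : ℝ) < Q.support.card := by exact_mod_cast this
  linarith

/-- **Same `y`-exponent: only for small `r`.** If the dominant pair has equal `y`-exponents then
`r ≤ R*`. [folklore] -/
theorem le_Rstar_of_eq {Q : MvPolynomial (Fin 2) ℝ} {r y : ℝ} (hr : 1 ≤ r) (hy : 0 < y)
    {d d' : Fin 2 →₀ ℕ} (hd : d ∈ Q.support) (hd' : d' ∈ Q.support) (hne : d ≠ d')
    (hb : d 1 = d' 1) (hle : term Q r y d' ≤ term Q r y d)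
    (hle' : term Q r y d ≤ ((Q.support.card : ℝ) - 1) * term Q r y d') :
    r ≤ Rstar Q (d, d') := by
  have hc : 0 < |Q.coeff d| := abs_pos.2 (MvPolynomial.mem_support_iff.1 hd)
  have hc' : 0 < |Q.coeff d'| := abs_pos.2 (MvPolynomial.mem_support_iff.1 hd')
  have hr0 : 0 < r := by linarith
  have hyb : 0 < y ^ (d 1) := pow_pos hy _
  have ha : d 0 ≠ d' 0 := by
    intro h
    apply hne
    ext i
    fin_cases i
    · exact h
    · exact hb
  unfold term at hle hle'
  rw [← hb] at hle hle'
  rcases Nat.lt_or_gt_of_ne ha with h | h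
  · -- `a < a'`: use `T_{d'} ≤ T_d`
    have h1 : |Q.coeff d'| * r ^ (d' 0) ≤ |Q.coeff d| * r ^ (d 0) := by
      have := hle
      nlinarith [hyb]
    have h2 : r ^ (d' 0) = r ^ (d' 0 - d 0) * r ^ (d 0) := (pow_sub_mul_pow r h.le).symm
    rw [h2] at h1
    have h3 : |Q.coeff d'| * r ^ (d' 0 - d 0) ≤ |Q.coeff d| :=
      le_of_mul_le_mul_right (by nlinarith [h1]) (pow_pos hr0 (d 0))
    have h4 : r ^ (d' 0 - d 0) ≤ (lam Q (d, d'))⁻¹ := by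
      unfold lam
      rw [inv_div, le_div_iff₀ hc']
      linarith [h3]
    have h5 : r ≤ r ^ (d' 0 - d 0) := le_self_pow₀ hr (Nat.sub_ne_zero_of_lt h)
    exact (h5.trans h4).trans (le_max_right _ _)
  · -- `a' < a`: use `T_d ≤ (n-1) T_{d'}`
    have h1 : |Q.coeff d| * r ^ (d 0) ≤ ((Q.support.card : ℝ) - 1) * (|Q.coeff d'| * r ^ (d' 0)) := by
      have := hle'
      nlinarith [hyb]
    have h2 : r ^ (d 0) = r ^ (d 0 - d' 0) * r ^ (d' 0) := (pow_sub_mul_pow r h.le).symm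
    rw [h2] at h1
    have h3 : |Q.coeff d| * r ^ (d 0 - d' 0) ≤ ((Q.support.card : ℝ) - 1) * |Q.coeff d'| :=
      le_of_mul_le_mul_right (by nlinarith [h1]) (pow_pos hr0 (d' 0))
    have h4 : r ^ (d 0 - d' 0) ≤ ((Q.support.card : ℝ) - 1) * lam Q (d, d') := by
      unfold lam
      rw [← mul_div_assoc, le_div_iff₀ hc]
      linarith [h3]
    have h5 : r ≤ r ^ (d 0 - d' 0) := le_self_pow₀ hr (Nat.sub_ne_zero_of_lt h)
    exact (h5.trans h4).trans (le_max_left _ _)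

/-- Between two powers: if `L ≤ y ^ e ≤ U` with `L > 0`, `e ≠ 0`, then `y` lies between `L ^ e⁻¹`
and `U ^ e⁻¹`. [folklore] -/
theorem between_rpow_inv {y e L U : ℝ} (hy : 0 < y) (he : e ≠ 0) (hL : 0 < L) (h1 : L ≤ y ^ e)
    (h2 : y ^ e ≤ U) :
    min (L ^ e⁻¹) (U ^ e⁻¹) ≤ y ∧ y ≤ max (L ^ e⁻¹) (U ^ e⁻¹) := by
  have hkey : (y ^ e) ^ e⁻¹ = y := Real.rpow_rpow_inv hy.le he
  have hye : 0 < y ^ e := Real.rpow_pos_of_pos hy e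
  rcases lt_or_gt_of_ne he with he' | he'
  · have hi : e⁻¹ ≤ 0 := (inv_lt_zero.2 he').le
    have hlo : U ^ e⁻¹ ≤ y := by
      rw [← hkey]; exact Real.rpow_le_rpow_of_nonpos hye h2 hi
    have hup : y ≤ L ^ e⁻¹ := by
      rw [← hkey]; exact Real.rpow_le_rpow_of_nonpos hL h1 hi
    exact ⟨(min_le_right _ _).trans hlo, hup.trans (le_max_left _ _)⟩
  · have hi : 0 ≤ e⁻¹ := (inv_pos.2 he').le
    have hlo : L ^ e⁻¹ ≤ y := by
      rw [← hkey]; exact Real.rpow_le_rpow hL.le h1 hi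
    have hup : y ≤ U ^ e⁻¹ := by
      rw [← hkey]; exact Real.rpow_le_rpow hye.le h2 hi
    exact ⟨(min_le_left _ _).trans hlo, hup.trans (le_max_right _ _)⟩

/-- **Different `y`-exponents: `y ≍ r ^ q`.** If the dominant pair has different `y`-exponents,
then `loConst r^q ≤ y ≤ hiConst r^q` with `q` the slope of the pair. [folklore] -/
theorem slope_bounds {Q : MvPolynomial (Fin 2) ℝ} {r y : ℝ} (hr : 1 ≤ r) (hy : 0 < y)
    {d d' : Fin 2 →₀ ℕ} (hd : d ∈ Q.support) (hd' : d' ∈ Q.support)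
    (hb : d 1 ≠ d' 1) (hle : term Q r y d' ≤ term Q r y d)
    (hle' : term Q r y d ≤ ((Q.support.card : ℝ) - 1) * term Q r y d') :
    loConst Q (d, d') * r ^ slope (d, d') ≤ y ∧ y ≤ hiConst Q (d, d') * r ^ slope (d, d') := by
  have hc : 0 < |Q.coeff d| := abs_pos.2 (MvPolynomial.mem_support_iff.1 hd)
  have hc' : 0 < |Q.coeff d'| := abs_pos.2 (MvPolynomial.mem_support_iff.1 hd')
  have hr0 : 0 < r := by linarith
  have he : expE (d, d') ≠ 0 := by
    unfold expE
    intro h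
    exact hb (by exact_mod_cast (sub_eq_zero.1 h))
  set Z : ℝ := |Q.coeff d| * (r ^ (d 0) * y ^ (d' 1)) with hZ
  have hZpos : 0 < Z := by positivity
  have hlam : 0 < lam Q (d, d') := lam_pos hd hd'
  -- `y ^ e = T_d / Z` and `λ r^f = T_{d'} / Z`
  have I1 : y ^ expE (d, d') = term Q r y d / Z := by
    unfold expE term
    rw [Real.rpow_sub hy, Real.rpow_natCast, Real.rpow_natCast, hZ]
    field_simp
  have I2 : lam Q (d, d') * r ^ expF (d, d') = term Q r y d' / Z := by
    unfold expF lam term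
    rw [Real.rpow_sub hr0, Real.rpow_natCast, Real.rpow_natCast, hZ]
    field_simp
  have hL : lam Q (d, d') * r ^ expF (d, d') ≤ y ^ expE (d, d') := by
    rw [I1, I2]; exact div_le_div_of_nonneg_right hle hZpos.le
  have hU : y ^ expE (d, d') ≤ ((Q.support.card : ℝ) - 1) * (lam Q (d, d') * r ^ expF (d, d')) := by
    rw [I1, I2, ← mul_div_assoc]; exact div_le_div_of_nonneg_right hle' hZpos.le
  have hLpos : 0 < lam Q (d, d') * r ^ expF (d, d') := mul_pos hlam (Real.rpow_pos_of_pos hr0 _)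
  obtain ⟨h1, h2⟩ := between_rpow_inv hy he hLpos hL hU
  have hrf : 0 ≤ r ^ expF (d, d') := (Real.rpow_pos_of_pos hr0 _).le
  have e1 : (lam Q (d, d') * r ^ expF (d, d')) ^ (expE (d, d'))⁻¹ =
      lam Q (d, d') ^ (expE (d, d'))⁻¹ * r ^ slope (d, d') := by
    rw [Real.mul_rpow hlam.le hrf, ← Real.rpow_mul hr0.le]; rfl
  have e2 : (((Q.support.card : ℝ) - 1) * (lam Q (d, d') * r ^ expF (d, d'))) ^ (expE (d, d'))⁻¹ =
      (((Q.support.card : ℝ) - 1) * lam Q (d, d')) ^ (expE (d, d'))⁻¹ * r ^ slope (d, d') := by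
    have hn : 0 ≤ (Q.support.card : ℝ) - 1 := by
      have : 1 ≤ Q.support.card := Finset.card_pos.2 ⟨d, hd⟩
      have : (1 : ℝ) ≤ Q.support.card := by exact_mod_cast this
      linarith
    rw [← mul_assoc, Real.mul_rpow (mul_nonneg hn hlam.le) hrf, ← Real.rpow_mul hr0.le]; rfl
  rw [e1, e2] at h1 h2
  have hrq : 0 ≤ r ^ slope (d, d') := (Real.rpow_pos_of_pos hr0 _).le
  constructor
  · rw [← min_mul_of_nonneg _ _ hrq] at h1; exact h1
  · rw [← max_mul_of_nonneg _ _ hrq] at h2; exact h2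

/-! ### Polynomial decay from an algebraic relation -/

/-- **Two-term decay lemma.** Let `Q(r, y)` be a nonzero real polynomial and `φ ≥ 0` a bounded
function on `ℝ` tending to `0` at `+∞` such that `Q(r, φ r) = 0` whenever `r ≥ 1` and `φ r > 0`.
Then `φ r ≤ C r^{-α}` for all `r ≥ 1`, for some `C` and some `α > 0` (indeed `α` is the least
absolute value of a negative slope of a pair of monomials of `Q`): at each such `r` two terms of `Q`
are comparable, which pins `φ r` between constant multiples of `r^q` for a slope `q`; slopes `q ≥ 0`
are excluded for large `r` because `φ → 0`. An elementary substitute for the Puiseux expansion at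
infinity of a semialgebraic function. [folklore] -/
theorem exists_le_rpow_neg_of_eval_eq_zero (Q : MvPolynomial (Fin 2) ℝ) (hQ : Q ≠ 0)
    {φ : ℝ → ℝ} {B : ℝ} (hφ0 : ∀ r, 0 ≤ φ r) (hφB : ∀ r, φ r ≤ B)
    (hlim : ∀ ε : ℝ, 0 < ε → ∃ r₀ : ℝ, ∀ r, r₀ ≤ r → φ r < ε)
    (hrel : ∀ r, 1 ≤ r → 0 < φ r → MvPolynomial.eval ![r, φ r] Q = 0) :
    ∃ C α : ℝ, 0 < α ∧ ∀ r, 1 ≤ r → φ r ≤ C * r ^ (-α) := by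
  classical
  set s := Q.support with hs
  set OD := s.offDiag with hOD
  set PB := OD.filter (fun π => π.1 1 ≠ π.2 1) with hPB
  set PBneg := PB.filter (fun π => slope π < 0) with hPBneg
  set PBnn := PB.filter (fun π => 0 ≤ slope π) with hPBnn
  have hB : 0 ≤ B := (hφ0 0).trans (hφB 0)
  -- thresholds and constants
  set Rbad : ℝ := 1 + ∑ π ∈ OD, Rstar Q π with hRbad
  have hRstar_lt : ∀ π ∈ OD, Rstar Q π < Rbad := by
    intro π hπ
    have hmem : π.1 ∈ s ∧ π.2 ∈ s := by
      rw [hOD, Finset.mem_offDiag] at hπ; exact ⟨hπ.1, hπ.2.1⟩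
    have := Finset.single_le_sum (f := fun π => Rstar Q π) (fun π' hπ' => by
      rw [hOD, Finset.mem_offDiag] at hπ'
      exact (Rstar_pos hπ'.1 hπ'.2.1).le) hπ
    linarith
  set kS : ℝ := ∑ π ∈ PB, hiConst Q π with hkS
  have hPBmem : ∀ π ∈ PB, π.1 ∈ s ∧ π.2 ∈ s ∧ π.1 ≠ π.2 ∧ π.1 1 ≠ π.2 1 := by
    intro π hπ
    rw [hPB, Finset.mem_filter, hOD, Finset.mem_offDiag] at hπ
    exact ⟨hπ.1.1, hπ.1.2.1, hπ.1.2.2, hπ.2⟩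
  have hkS_ge : ∀ π ∈ PB, hiConst Q π ≤ kS := fun π hπ =>
    Finset.single_le_sum (f := fun π => hiConst Q π)
      (fun π' hπ' => (hiConst_pos (hPBmem π' hπ').1 (hPBmem π' hπ').2.1).le) hπ
  have hkS0 : 0 ≤ kS :=
    Finset.sum_nonneg fun π' hπ' => (hiConst_pos (hPBmem π' hπ').1 (hPBmem π' hπ').2.1).le
  set α : ℝ := if h : PBneg.Nonempty then PBneg.inf' h (fun π => -slope π) else 1 with hα
  have hαpos : 0 < α := by
    rw [hα]
    split_ifs with h
    · rw [Finset.lt_inf'_iff]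
      intro π hπ
      rw [hPBneg, Finset.mem_filter] at hπ
      linarith [hπ.2]
    · exact one_pos
  have hαle : ∀ π ∈ PBneg, α ≤ -slope π := by
    intro π hπ
    have hne : PBneg.Nonempty := ⟨π, hπ⟩
    rw [hα, dif_pos hne]
    exact Finset.inf'_le _ hπ
  set km : ℝ := if h : PBnn.Nonempty then PBnn.inf' h (loConst Q) else 1 with hkm
  have hkm_pos : 0 < km := by
    rw [hkm]
    split_ifs with h
    · rw [Finset.lt_inf'_iff]
      intro π hπ
      rw [hPBnn, Finset.mem_filter] at hπ
      obtain ⟨h1, h2, h3, -⟩ := hPBmem π hπ.1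
      exact loConst_pos h1 h2 (one_lt_card_of_ne h1 h2 h3)
    · exact one_pos
  have hkm_le : ∀ π ∈ PBnn, km ≤ loConst Q π := by
    intro π hπ
    have hne : PBnn.Nonempty := ⟨π, hπ⟩
    rw [hkm, dif_pos hne]
    exact Finset.inf'_le _ hπ
  obtain ⟨r₁, hr₁⟩ := hlim km hkm_pos
  set R₁ : ℝ := max (max Rbad r₁) 1 with hR₁
  have hR₁1 : 1 ≤ R₁ := le_max_right _ _
  -- the decay beyond `R₁`
  have hmain : ∀ r, R₁ ≤ r → φ r ≤ kS * r ^ (-α) := by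
    intro r hr
    have hr1 : 1 ≤ r := hR₁1.trans hr
    have hr0 : 0 < r := by linarith
    rcases (hφ0 r).eq_or_lt with h0 | hpos
    · rw [← h0]; exact mul_nonneg hkS0 (Real.rpow_nonneg hr0.le _)
    obtain ⟨d, hd, d', hd', hne, hle, hle'⟩ :=
      exists_dominant_pair hr0 hpos (hrel r hr1 hpos) hQ
    by_cases hb : d 1 = d' 1
    · exfalso
      have h1 := le_Rstar_of_eq hr1 hpos hd hd' hne hb hle hle'
      have h2 : Rstar Q (d, d') < Rbad :=
        hRstar_lt (d, d') (by rw [hOD, Finset.mem_offDiag]; exact ⟨hd, hd', hne⟩)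
      have h3 : Rbad ≤ R₁ := (le_max_left _ _).trans (le_max_left _ _)
      linarith
    · have hπ : (d, d') ∈ PB := by
        rw [hPB, Finset.mem_filter, hOD, Finset.mem_offDiag]
        exact ⟨⟨hd, hd', hne⟩, hb⟩
      obtain ⟨hlo, hup⟩ := slope_bounds hr1 hpos hd hd' hb hle hle'
      by_cases hq : 0 ≤ slope (d, d')
      · exfalso
        have hπ' : (d, d') ∈ PBnn := by rw [hPBnn, Finset.mem_filter]; exact ⟨hπ, hq⟩
        have h1 : km ≤ loConst Q (d, d') := hkm_le _ hπ'
        have h2 : 1 ≤ r ^ slope (d, d') := Real.one_le_rpow hr1 hq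
        have h3 : φ r < km := hr₁ r ((le_max_right _ _).trans ((le_max_left _ _).trans hr))
        have h4 : 0 < loConst Q (d, d') := loConst_pos hd hd' (one_lt_card_of_ne hd hd' hne)
        nlinarith
      · replace hq : slope (d, d') < 0 := not_le.1 hq
        have hπ' : (d, d') ∈ PBneg := by rw [hPBneg, Finset.mem_filter]; exact ⟨hπ, hq⟩
        have h1 : slope (d, d') ≤ -α := by linarith [hαle _ hπ']
        have h2 : r ^ slope (d, d') ≤ r ^ (-α) := Real.rpow_le_rpow_of_exponent_le hr1 h1
        have h3 : hiConst Q (d, d') ≤ kS := hkS_ge _ hπ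
        have h4 : 0 < hiConst Q (d, d') := hiConst_pos hd hd'
        calc φ r ≤ hiConst Q (d, d') * r ^ slope (d, d') := hup
          _ ≤ hiConst Q (d, d') * r ^ (-α) := mul_le_mul_of_nonneg_left h2 h4.le
          _ ≤ kS * r ^ (-α) := mul_le_mul_of_nonneg_right h3 (Real.rpow_nonneg hr0.le _)
  -- the initial segment `1 ≤ r ≤ R₁`
  refine ⟨max kS (B * R₁ ^ α), α, hαpos, fun r hr => ?_⟩
  have hr0 : 0 < r := by linarith
  have hrα : 0 ≤ r ^ (-α) := Real.rpow_nonneg hr0.le _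
  rcases le_or_gt R₁ r with h | h
  · exact (hmain r h).trans (mul_le_mul_of_nonneg_right (le_max_left _ _) hrα)
  · have h1 : R₁ ^ (-α) ≤ r ^ (-α) :=
      Real.rpow_le_rpow_of_nonpos hr0 h.le (by linarith)
    have h2 : B * R₁ ^ α * R₁ ^ (-α) = B := by
      rw [mul_assoc, ← Real.rpow_add (by linarith), add_neg_cancel, Real.rpow_zero, mul_one]
    calc φ r ≤ B := hφB r
      _ = B * R₁ ^ α * R₁ ^ (-α) := h2.symm
      _ ≤ B * R₁ ^ α * r ^ (-α) :=
          mul_le_mul_of_nonneg_left h1 (mul_nonneg hB (Real.rpow_nonneg (by linarith) _))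
      _ ≤ max kS (B * R₁ ^ α) * r ^ (-α) := mul_le_mul_of_nonneg_right (le_max_right _ _) hrα

/-! ### Down-sets in the positive orthant: boxes and the box-volume profile -/

section DownSet

variable {n : ℕ}

/-- The largest coordinate of a point of `ℝ^{n+1}`. [folklore] -/
def msup (x : Fin (n + 1) → ℝ) : ℝ := Finset.univ.sup' Finset.univ_nonempty x

/-- Each coordinate is at most the largest one. [folklore] -/
theorem le_msup (x : Fin (n + 1) → ℝ) (i : Fin (n + 1)) : x i ≤ msup x :=
  Finset.le_sup' x (Finset.mem_univ i)

/-- The largest coordinate is attained. [folklore] -/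
theorem exists_msup_eq (x : Fin (n + 1) → ℝ) : ∃ i, msup x = x i := by
  obtain ⟨i, -, hi⟩ := Finset.exists_mem_eq_sup' (Finset.univ_nonempty (α := Fin (n + 1))) x
  exact ⟨i, hi⟩

/-- The half-open box `∏ (0, xᵢ]` below a point `x`. [folklore] -/
def box (x : Fin (n + 1) → ℝ) : Set (Fin (n + 1) → ℝ) := Set.pi univ fun i => Ioc 0 (x i)

/-- Boxes are measurable. [folklore] -/
theorem measurableSet_box (x : Fin (n + 1) → ℝ) : MeasurableSet (box x) :=
  MeasurableSet.univ_pi fun _ => measurableSet_Ioc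

/-- The volume of the box below `x ≥ 0` is `∏ xᵢ`. [folklore] -/
theorem volume_box {x : Fin (n + 1) → ℝ} (hx : ∀ i, 0 ≤ x i) :
    volume (box x) = ENNReal.ofReal (∏ i, x i) := by
  unfold box
  rw [Real.volume_pi_Ioc, ENNReal.ofReal_prod_of_nonneg fun i _ => hx i]
  simp

/-- The set of box volumes `∏ xᵢ` of the points `x ∈ D` with largest coordinate `≥ r`. [folklore] -/
def boxVols (D : Set (Fin (n + 1) → ℝ)) (r : ℝ) : Set ℝ :=
  {p | ∃ x ∈ D, r ≤ msup x ∧ p = ∏ i, x i}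

/-- The box-volume profile `M(r) = sup {∏ xᵢ | x ∈ D, max xᵢ ≥ r}` (with `sup ∅ = 0`). [folklore] -/
def M (D : Set (Fin (n + 1) → ℝ)) (r : ℝ) : ℝ := sSup (insert 0 (boxVols D r))

variable {D : Set (Fin (n + 1) → ℝ)}

/-- In a down-set of the open positive orthant, the box below any of its points lies in the set.
[folklore] -/
theorem box_subset (hdown : ∀ x ∈ D, ∀ y : Fin (n + 1) → ℝ, (∀ i, 0 < y i ∧ y i ≤ x i) → y ∈ D)
    {x : Fin (n + 1) → ℝ} (hx : x ∈ D) : box x ⊆ D := by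
  intro y hy
  refine hdown x hx y fun i => ?_
  have := hy i (mem_univ i)
  exact ⟨this.1, this.2⟩

/-- Box volumes of points of a finite-volume down-set are at most `vol D`. [folklore] -/
theorem prod_le_toReal (hpos : ∀ x ∈ D, ∀ i, 0 < x i)
    (hdown : ∀ x ∈ D, ∀ y : Fin (n + 1) → ℝ, (∀ i, 0 < y i ∧ y i ≤ x i) → y ∈ D)
    (hfin : volume D ≠ ⊤) {x : Fin (n + 1) → ℝ} (hx : x ∈ D) :
    ∏ i, x i ≤ (volume D).toReal := by
  have h1 : volume (box x) ≤ volume D := measure_mono (box_subset hdown hx)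
  rw [volume_box fun i => (hpos x hx i).le] at h1
  exact (ENNReal.ofReal_le_iff_le_toReal hfin).1 h1

/-- The set of box volumes is bounded above by `vol D`. [folklore] -/
theorem bddAbove_insert_boxVols (hpos : ∀ x ∈ D, ∀ i, 0 < x i)
    (hdown : ∀ x ∈ D, ∀ y : Fin (n + 1) → ℝ, (∀ i, 0 < y i ∧ y i ≤ x i) → y ∈ D)
    (hfin : volume D ≠ ⊤) (r : ℝ) : BddAbove (insert 0 (boxVols D r)) := by
  refine ⟨(volume D).toReal, ?_⟩
  rintro p hp
  rcases Set.mem_insert_iff.1 hp with rfl | ⟨x, hx, -, rfl⟩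
  · exact ENNReal.toReal_nonneg
  · exact prod_le_toReal hpos hdown hfin hx

/-- The profile is nonnegative. [folklore] -/
theorem M_nonneg (hpos : ∀ x ∈ D, ∀ i, 0 < x i)
    (hdown : ∀ x ∈ D, ∀ y : Fin (n + 1) → ℝ, (∀ i, 0 < y i ∧ y i ≤ x i) → y ∈ D)
    (hfin : volume D ≠ ⊤) (r : ℝ) : 0 ≤ M D r :=
  le_csSup (bddAbove_insert_boxVols hpos hdown hfin r) (Set.mem_insert _ _)

/-- The profile is at most `vol D`. [folklore] -/
theorem M_le_toReal (hpos : ∀ x ∈ D, ∀ i, 0 < x i)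
    (hdown : ∀ x ∈ D, ∀ y : Fin (n + 1) → ℝ, (∀ i, 0 < y i ∧ y i ≤ x i) → y ∈ D)
    (hfin : volume D ≠ ⊤) (r : ℝ) : M D r ≤ (volume D).toReal := by
  refine csSup_le (Set.insert_nonempty _ _) ?_
  rintro p hp
  rcases Set.mem_insert_iff.1 hp with rfl | ⟨x, hx, -, rfl⟩
  · exact ENNReal.toReal_nonneg
  · exact prod_le_toReal hpos hdown hfin hx

/-- The profile dominates the box volumes at its scale. [folklore] -/
theorem prod_le_M (hpos : ∀ x ∈ D, ∀ i, 0 < x i)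
    (hdown : ∀ x ∈ D, ∀ y : Fin (n + 1) → ℝ, (∀ i, 0 < y i ∧ y i ≤ x i) → y ∈ D)
    (hfin : volume D ≠ ⊤) {x : Fin (n + 1) → ℝ} (hx : x ∈ D) {r : ℝ} (hr : r ≤ msup x) :
    ∏ i, x i ≤ M D r :=
  le_csSup (bddAbove_insert_boxVols hpos hdown hfin r) (Set.mem_insert_of_mem _ ⟨x, hx, hr, rfl⟩)

/-- The profile is antitone. [folklore] -/
theorem M_antitone (hpos : ∀ x ∈ D, ∀ i, 0 < x i)
    (hdown : ∀ x ∈ D, ∀ y : Fin (n + 1) → ℝ, (∀ i, 0 < y i ∧ y i ≤ x i) → y ∈ D)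
    (hfin : volume D ≠ ⊤) : Antitone (M D) := by
  intro r r' hrr'
  refine csSup_le_csSup (bddAbove_insert_boxVols hpos hdown hfin r) (Set.insert_nonempty _ _) ?_
  refine Set.insert_subset_insert ?_
  rintro p ⟨x, hx, hr, rfl⟩
  exact ⟨x, hx, hrr'.trans hr, rfl⟩

/-- Radii `ρ₀ = 1`, `ρ_{j+1} = 2 F(ρ_j) + 1` (bookkeeping for the disjoint-boxes argument). [folklore] -/
def radii (F : ℝ → ℝ) : ℕ → ℝ
  | 0 => 1
  | j + 1 => 2 * F (radii F j) + 1

/-- **Boxes of eccentric points are small.** In a down-set `D` of the open positive orthant of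
finite volume, `M(r) → 0`: for every `δ > 0` some `M(r) < δ`. Otherwise there are points
`x⁽ʲ⁾ ∈ D` with `∏ xᵢ⁽ʲ⁾ > δ/2` and rapidly increasing largest coordinates `s_{j+1} > 2 s_j`; the sets
`box(x⁽ʲ⁾) ∖ (0, s_j/2]^{n+1} ⊆ D` are pairwise disjoint of volume `≥ δ/4`, so `vol D = ∞`.
[folklore] -/
theorem exists_M_lt (hpos : ∀ x ∈ D, ∀ i, 0 < x i)
    (hdown : ∀ x ∈ D, ∀ y : Fin (n + 1) → ℝ, (∀ i, 0 < y i ∧ y i ≤ x i) → y ∈ D)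
    (hfin : volume D ≠ ⊤) {δ : ℝ} (hδ : 0 < δ) : ∃ r, M D r < δ := by
  classical
  by_contra hcon
  push Not at hcon
  -- points with large boxes at every scale
  have pick : ∀ r : ℝ, ∃ x ∈ D, r ≤ msup x ∧ δ / 2 < ∏ i, x i := by
    intro r
    have hlt : δ / 2 < sSup (insert 0 (boxVols D r)) := by
      have := hcon r; unfold M at this; linarith
    obtain ⟨p, hp, hp2⟩ := exists_lt_of_lt_csSup (Set.insert_nonempty _ _) hlt
    rcases Set.mem_insert_iff.1 hp with rfl | ⟨x, hx, hrx, rfl⟩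
    · linarith
    · exact ⟨x, hx, hrx, hp2⟩
  choose g hgD hgr hgp using pick
  set ρ : ℕ → ℝ := radii (fun r => msup (g r)) with hρ
  set sz : ℕ → ℝ := fun j => msup (g (ρ j)) with hsz
  have hρsucc : ∀ j, ρ (j + 1) = 2 * sz j + 1 := fun j => rfl
  have hsz_ge : ∀ j, ρ j ≤ sz j := fun j => hgr (ρ j)
  have hρ_ge : ∀ j, 1 ≤ ρ j := by
    intro j
    induction j with
    | zero => exact le_rfl
    | succ j ih => rw [hρsucc]; linarith [hsz_ge j]
  have hsz_pos : ∀ j, 0 < sz j := fun j => lt_of_lt_of_le one_pos ((hρ_ge j).trans (hsz_ge j))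
  have hsz_succ : ∀ j, 2 * sz j < sz (j + 1) := fun j => by
    have := hsz_ge (j + 1); rw [hρsucc] at this; linarith
  have hsz_mono : StrictMono sz := strictMono_nat_of_lt_succ fun j => by
    linarith [hsz_succ j, hsz_pos j]
  have hsz_lt : ∀ j j', j < j' → 2 * sz j < sz j' := by
    intro j j' hjj'
    have h1 : sz (j + 1) ≤ sz j' := hsz_mono.monotone hjj'
    linarith [hsz_succ j]
  -- the disjoint pieces
  set cube : ℕ → Set (Fin (n + 1) → ℝ) := fun j => Set.pi univ fun _ => Ioc (0 : ℝ) (sz j / 2)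
    with hcube
  set B : ℕ → Set (Fin (n + 1) → ℝ) := fun j => box (g (ρ j)) \ cube j with hB
  have hBm : ∀ j, MeasurableSet (B j) := fun j =>
    (measurableSet_box _).diff (MeasurableSet.univ_pi fun _ => measurableSet_Ioc)
  have hBD : ∀ j, B j ⊆ D := fun j y hy => box_subset hdown (hgD _) hy.1
  have hdisj : Pairwise (Function.onFun Disjoint B) := by
    intro j j' hne
    wlog hlt : j < j' generalizing j j'
    · exact (this hne.symm (lt_of_le_of_ne (not_lt.1 hlt) hne.symm)).symm
    rw [Function.onFun, Set.disjoint_left]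
    intro y hy hy'
    have hy1 : ∀ i, y i ≤ sz j := fun i =>
      ((hy.1 i (mem_univ i)).2).trans (le_msup _ i)
    have hy2 : ∃ i, sz j' / 2 < y i := by
      by_contra h
      push Not at h
      exact hy'.2 fun i _ => ⟨(hy'.1 i (mem_univ i)).1, h i⟩
    obtain ⟨i, hi⟩ := hy2
    linarith [hy1 i, hsz_lt j j' hlt]
  -- each piece has volume `≥ δ/4`
  have hvol : ∀ j, ENNReal.ofReal (δ / 4) ≤ volume (B j) := by
    intro j
    set x := g (ρ j) with hx
    have hxpos : ∀ i, 0 < x i := hpos x (hgD _)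
    have hcap : box x ∩ cube j = Set.pi univ fun i => Ioc 0 (min (x i) (sz j / 2)) := by
      rw [box, hcube, ← Set.pi_inter_distrib]
      congr 1
      funext i
      rw [Set.Ioc_inter_Ioc, max_self]
    have hvcap : volume (box x ∩ cube j) ≤ ENNReal.ofReal ((∏ i, x i) / 2) := by
      rw [hcap, Real.volume_pi_Ioc]
      simp only [sub_zero]
      rw [← ENNReal.ofReal_prod_of_nonneg fun i _ => (lt_min (hxpos i) (by linarith [hsz_pos j])).le]
      refine ENNReal.ofReal_le_ofReal ?_
      obtain ⟨i₀, hi₀⟩ := exists_msup_eq x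
      rw [← Finset.mul_prod_erase Finset.univ (fun i => min (x i) (sz j / 2)) (Finset.mem_univ i₀),
        ← Finset.mul_prod_erase Finset.univ x (Finset.mem_univ i₀)]
      have hsj : sz j = x i₀ := hi₀
      have h1 : min (x i₀) (sz j / 2) ≤ x i₀ / 2 := by
        rw [hsj]; exact min_le_right _ _
      have h2 : ∏ i ∈ Finset.univ.erase i₀, min (x i) (sz j / 2) ≤
          ∏ i ∈ Finset.univ.erase i₀, x i :=
        Finset.prod_le_prod (fun i _ => (lt_min (hxpos i) (by linarith [hsz_pos j])).le)
          fun i _ => min_le_left _ _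
      have h3 : 0 ≤ ∏ i ∈ Finset.univ.erase i₀, min (x i) (sz j / 2) :=
        Finset.prod_nonneg fun i _ => (lt_min (hxpos i) (by linarith [hsz_pos j])).le
      have h4 : 0 ≤ x i₀ / 2 := by linarith [hxpos i₀]
      have h5 := mul_le_mul h1 h2 h3 h4
      have h6 : x i₀ / 2 * ∏ i ∈ Finset.univ.erase i₀, x i =
          (x i₀ * ∏ i ∈ Finset.univ.erase i₀, x i) / 2 := by ring
      simpa only [h6] using h5
    have hle : volume (box x) ≤ volume (B j) + volume (box x ∩ cube j) := by
      calc volume (box x) ≤ volume (B j ∪ (box x ∩ cube j)) := measure_mono fun y hy => by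
            by_cases h : y ∈ cube j
            · exact Or.inr ⟨hy, h⟩
            · exact Or.inl ⟨hy, h⟩
        _ ≤ volume (B j) + volume (box x ∩ cube j) := measure_union_le _ _
    rw [volume_box fun i => (hxpos i).le] at hle
    have hp0 : 0 ≤ (∏ i, x i) / 2 := by
      have : 0 ≤ ∏ i, x i := Finset.prod_nonneg fun i _ => (hxpos i).le
      linarith
    have h1 : ENNReal.ofReal (∏ i, x i) - ENNReal.ofReal ((∏ i, x i) / 2) ≤ volume (B j) :=
      tsub_le_iff_right.2 (hle.trans (add_le_add le_rfl hvcap))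
    rw [← ENNReal.ofReal_sub _ hp0] at h1
    refine le_trans (ENNReal.ofReal_le_ofReal ?_) h1
    linarith [hgp (ρ j)]
  -- summing `K` of them exceeds the volume of `D`
  obtain ⟨K, hK⟩ := exists_nat_gt (4 * (volume D).toReal / δ)
  have hsum : ∑ j ∈ Finset.range K, volume (B j) ≤ volume D := by
    rw [← measure_biUnion_finset (fun j _ j' _ hne => hdisj hne) fun j _ => hBm j]
    exact measure_mono (Set.iUnion₂_subset fun j _ => hBD j)
  have hsum' : (K : ℝ≥0∞) * ENNReal.ofReal (δ / 4) ≤ volume D := by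
    calc (K : ℝ≥0∞) * ENNReal.ofReal (δ / 4) = ∑ j ∈ Finset.range K, ENNReal.ofReal (δ / 4) := by
          rw [Finset.sum_const, Finset.card_range, nsmul_eq_mul]
      _ ≤ ∑ j ∈ Finset.range K, volume (B j) := Finset.sum_le_sum fun j _ => hvol j
      _ ≤ volume D := hsum
  have hK' : (K : ℝ) * (δ / 4) ≤ (volume D).toReal := by
    have h1 : (K : ℝ≥0∞) * ENNReal.ofReal (δ / 4) = ENNReal.ofReal ((K : ℝ) * (δ / 4)) := by
      rw [ENNReal.ofReal_mul (Nat.cast_nonneg K), ENNReal.ofReal_natCast]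
    rw [h1] at hsum'
    exact (ENNReal.ofReal_le_iff_le_toReal hfin).1 hsum'
  have : 4 * (volume D).toReal / δ * δ = 4 * (volume D).toReal := div_mul_cancel₀ _ hδ.ne'
  nlinarith

/-! ### The plane set of (scale, box volume) pairs and the frontier relation -/

/-- The plane set `P = {(r, z) | ∃ x ∈ D, r ≤ max xᵢ ∧ z ≤ ∏ xᵢ}` whose upper boundary is the graph
of the profile `M`. [folklore] -/
def planeSet (D : Set (Fin (n + 1) → ℝ)) : Set (Fin 2 → ℝ) :=
  {v | ∃ x ∈ D, v 0 ≤ msup x ∧ v 1 ≤ ∏ i, x i}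

open Literature.ModelTheory.ExponentialFields MvPolynomial in
/-- The plane set of a `ℚ`-semialgebraic `D` is `ℚ`-semialgebraic (a coordinate projection of
`{(r, z, x) | x ∈ D, ∃ i, r ≤ xᵢ, z ≤ ∏ xᵢ}`; Tarski–Seidenberg). [cite: BochnakCosteRoy1998, Thm. 2.2.1] -/
theorem isSemialgebraic_planeSet (hD : IsSemialgebraic ℚ D) : IsSemialgebraic ℚ (planeSet D) := by
  set W : Set (Fin (2 + (n + 1)) → ℝ) :=
    ((fun w : Fin (2 + (n + 1)) → ℝ => w ∘ Fin.natAdd 2) ⁻¹' D) ∩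
      ((⋃ i ∈ (Finset.univ : Finset (Fin (n + 1))),
        {w : Fin (2 + (n + 1)) → ℝ | w (Fin.castAdd (n + 1) 0) ≤ w (Fin.natAdd 2 i)}) ∩
      {w : Fin (2 + (n + 1)) → ℝ | w (Fin.castAdd (n + 1) 1) ≤ ∏ i, w (Fin.natAdd 2 i)}) with hW
  have hWs : IsSemialgebraic ℚ W := by
    refine (hD.preimage_comp _).inter ((IsSemialgebraic.biUnion _ _ fun i _ => ?_).inter ?_)
    · have := isSemialgebraic_setOf_eval_le (k := ℚ) (R := ℝ)
        (X (Fin.castAdd (n + 1) 0) : MvPolynomial (Fin (2 + (n + 1))) ℚ) (X (Fin.natAdd 2 i))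
      simpa using this
    · have := isSemialgebraic_setOf_eval_le (k := ℚ) (R := ℝ)
        (X (Fin.castAdd (n + 1) 1) : MvPolynomial (Fin (2 + (n + 1))) ℚ) (∏ i, X (Fin.natAdd 2 i))
      simpa [map_prod] using this
  convert hWs.image_comp (Fin.castAdd (n + 1)) using 1
  ext v
  simp only [planeSet, mem_setOf_eq, mem_image, hW, mem_inter_iff, mem_preimage, mem_iUnion,
    Finset.mem_univ, exists_true_left]
  constructor
  · rintro ⟨x, hx, h0, h1⟩
    obtain ⟨i, hi⟩ := (Finset.le_sup'_iff _).1 h0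
    refine ⟨Fin.append v x, ⟨?_, ⟨i, ?_⟩, ?_⟩, ?_⟩
    · have : (Fin.append v x ∘ Fin.natAdd 2) = x := funext fun j => by simp
      rw [this]; exact hx
    · simpa using hi.2
    · simpa using h1
    · exact funext fun j => by simp
  · rintro ⟨w, ⟨hw, ⟨i, hi⟩, h1⟩, rfl⟩
    exact ⟨w ∘ Fin.natAdd 2, hw, le_trans hi (le_msup (w ∘ Fin.natAdd 2) i), h1⟩

/-- A positive profile value comes from a nonempty set of box volumes. [folklore] -/
theorem boxVols_nonempty_of_M_pos {r : ℝ} (hM : 0 < M D r) : (boxVols D r).Nonempty := by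
  by_contra h
  rw [Set.not_nonempty_iff_eq_empty] at h
  unfold M at hM
  rw [h, insert_empty_eq, csSup_singleton] at hM
  exact lt_irrefl _ hM

/-- Points strictly below the profile belong to the plane set. [folklore] -/
theorem mem_planeSet_of_lt (hpos : ∀ x ∈ D, ∀ i, 0 < x i)
    {r z : ℝ} (hM : 0 < M D r) (hz : z < M D r) : ![r, z] ∈ planeSet D := by
  obtain ⟨p, hp, hzp⟩ := exists_lt_of_lt_csSup (Set.insert_nonempty _ _) hz
  rcases Set.mem_insert_iff.1 hp with rfl | ⟨x, hx, hrx, rfl⟩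
  · obtain ⟨_, x, hx, hrx, rfl⟩ := boxVols_nonempty_of_M_pos hM
    refine ⟨x, hx, by simpa using hrx, ?_⟩
    have : 0 < ∏ i, x i := Finset.prod_pos fun i _ => hpos x hx i
    simp only [Matrix.cons_val_one, Matrix.cons_val_zero]
    linarith
  · exact ⟨x, hx, by simpa using hrx, by simpa using hzp.le⟩

/-- Points strictly above the profile do not belong to the plane set. [folklore] -/
theorem not_mem_planeSet_of_gt (hpos : ∀ x ∈ D, ∀ i, 0 < x i)
    (hdown : ∀ x ∈ D, ∀ y : Fin (n + 1) → ℝ, (∀ i, 0 < y i ∧ y i ≤ x i) → y ∈ D)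
    (hfin : volume D ≠ ⊤) {r z : ℝ} (hz : M D r < z) : ![r, z] ∉ planeSet D := by
  rintro ⟨x, hx, hrx, hzx⟩
  simp only [Matrix.cons_val_zero, Matrix.cons_val_one] at hrx hzx
  have := prod_le_M hpos hdown hfin hx hrx
  linarith

/-- For `M(r) > 0` the point `(r, M(r))` lies on the frontier of the plane set. [folklore] -/
theorem mem_frontier_planeSet (hpos : ∀ x ∈ D, ∀ i, 0 < x i)
    (hdown : ∀ x ∈ D, ∀ y : Fin (n + 1) → ℝ, (∀ i, 0 < y i ∧ y i ≤ x i) → y ∈ D)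
    (hfin : volume D ≠ ⊤) {r : ℝ} (hM : 0 < M D r) : ![r, M D r] ∈ frontier (planeSet D) := by
  rw [frontier_eq_closure_inter_closure]
  constructor
  · rw [Metric.mem_closure_iff]
    intro ε hε
    refine ⟨![r, M D r - ε / 2], mem_planeSet_of_lt hpos hM (by linarith), ?_⟩
    rw [dist_pi_lt_iff hε]
    intro i
    fin_cases i
    · simp [hε]
    · simp only [Fin.mk_one, Matrix.cons_val_one, Matrix.cons_val_zero, Real.dist_eq]
      rw [show M D r - (M D r - ε / 2) = ε / 2 by ring, abs_of_pos (by linarith)]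
      linarith
  · rw [Metric.mem_closure_iff]
    intro ε hε
    refine ⟨![r, M D r + ε / 2], not_mem_planeSet_of_gt hpos hdown hfin (by linarith), ?_⟩
    rw [dist_pi_lt_iff hε]
    intro i
    fin_cases i
    · simp [hε]
    · simp only [Fin.mk_one, Matrix.cons_val_one, Matrix.cons_val_zero, Real.dist_eq]
      rw [show M D r - (M D r + ε / 2) = -(ε / 2) by ring, abs_neg, abs_of_pos (by linarith)]
      linarith

open Literature.ModelTheory.ExponentialFields in
/-- **Boxes are polynomially small.** In a `ℚ`-semialgebraic down-set of the open positive
orthant of finite volume, `∏ xᵢ ≤ C (max xᵢ)^{-α}` for all `x ∈ D` with `max xᵢ ≥ 1`, for some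
`C, α > 0`: the frontier of the plane set lies in the zero set of a nonzero polynomial `Q`
(`SemialgVolume.exists_ne_zero_frontier_subset`), so `Q(r, M(r)) = 0` whenever `M(r) > 0`, and the
two-term decay lemma applies to the antitone profile `M → 0`. [folklore] -/
theorem exists_prod_le_mul_rpow (hD : IsSemialgebraic ℚ D) (hpos : ∀ x ∈ D, ∀ i, 0 < x i)
    (hdown : ∀ x ∈ D, ∀ y : Fin (n + 1) → ℝ, (∀ i, 0 < y i ∧ y i ≤ x i) → y ∈ D)
    (hfin : volume D ≠ ⊤) :
    ∃ C α : ℝ, 0 < C ∧ 0 < α ∧ ∀ x ∈ D, 1 ≤ msup x → ∏ i, x i ≤ C * msup x ^ (-α) := by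
  obtain ⟨Q, hQ, hfr⟩ := SemialgVolume.exists_ne_zero_frontier_subset (isSemialgebraic_planeSet hD)
  have hlim : ∀ ε : ℝ, 0 < ε → ∃ r₀ : ℝ, ∀ r, r₀ ≤ r → M D r < ε := by
    intro ε hε
    obtain ⟨r₀, hr₀⟩ := exists_M_lt hpos hdown hfin hε
    exact ⟨r₀, fun r hr => lt_of_le_of_lt (M_antitone hpos hdown hfin hr) hr₀⟩
  have hrel : ∀ r, 1 ≤ r → 0 < M D r → MvPolynomial.eval ![r, M D r] Q = 0 :=
    fun r _ hM => hfr (mem_frontier_planeSet hpos hdown hfin hM)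
  obtain ⟨C, α, hα, hC⟩ := exists_le_rpow_neg_of_eval_eq_zero Q hQ (M_nonneg hpos hdown hfin)
    (M_le_toReal hpos hdown hfin) hlim hrel
  refine ⟨max C 1, α, lt_max_of_lt_right one_pos, hα, fun x hx h1 => ?_⟩
  have h0 : 0 ≤ msup x ^ (-α) := Real.rpow_nonneg (by linarith) _
  calc ∏ i, x i ≤ M D (msup x) := prod_le_M hpos hdown hfin hx le_rfl
    _ ≤ C * msup x ^ (-α) := hC _ h1
    _ ≤ max C 1 * msup x ^ (-α) := mul_le_mul_of_nonneg_right (le_max_left _ _) h0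

/-! ### The tail estimate -/

/-- **Markov-power bound.** For `0 < θ < 1`, the set `{y ∈ (0, L]^{n+1} | ∏ yⱼ ≤ K}` has volume at
most `K^θ (L^{1-θ}/(1-θ))^{n+1}`: its indicator is `≤ (K/∏ yⱼ)^θ = K^θ ∏ yⱼ^{-θ}` on the cube, and
the integral of the product splits (Fubini). [folklore] -/
theorem volume_prodLe_le {L K θ : ℝ} (hL : 0 < L) (hK : 0 < K) (hθ0 : 0 < θ) (hθ1 : θ < 1) :
    volume {x : Fin (n + 1) → ℝ | (∀ j, 0 < x j ∧ x j ≤ L) ∧ ∏ j, x j ≤ K} ≤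
      ENNReal.ofReal (K ^ θ * (L ^ (1 - θ) / (1 - θ)) ^ (n + 1)) := by
  set V := {x : Fin (n + 1) → ℝ | (∀ j, 0 < x j ∧ x j ≤ L) ∧ ∏ j, x j ≤ K} with hV
  set g : ℝ → ℝ := (Ioc 0 L).indicator fun t => t ^ (-θ) with hg
  set F : (Fin (n + 1) → ℝ) → ℝ := fun x => K ^ θ * ∏ j, g (x j) with hF
  have hVm : MeasurableSet V := by
    have h1 : MeasurableSet {x : Fin (n + 1) → ℝ | ∀ j, 0 < x j ∧ x j ≤ L} := by
      have : {x : Fin (n + 1) → ℝ | ∀ j, 0 < x j ∧ x j ≤ L} = Set.pi univ fun _ => Ioc 0 L := by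
        ext x; simp [Set.mem_pi]
      rw [this]; exact MeasurableSet.univ_pi fun _ => measurableSet_Ioc
    have h2 : MeasurableSet {x : Fin (n + 1) → ℝ | ∏ j, x j ≤ K} :=
      measurableSet_le (Finset.measurable_prod _ fun j _ => measurable_pi_apply j) measurable_const
    rw [hV, Set.setOf_and]
    exact h1.inter h2
  have hg0 : ∀ t, 0 ≤ g t := fun t => by
    rw [hg]
    exact Set.indicator_nonneg (fun u hu => Real.rpow_nonneg hu.1.le _) t
  have hgi : Integrable g := by
    rw [hg, integrable_indicator_iff measurableSet_Ioc]
    exact (intervalIntegral.intervalIntegrable_rpow' (a := 0) (b := L) (by linarith : -1 < -θ)).1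
  have hgint : ∫ t, g t = L ^ (1 - θ) / (1 - θ) := by
    rw [hg, integral_indicator measurableSet_Ioc, ← intervalIntegral.integral_of_le hL.le,
      integral_rpow (Or.inl (by linarith : -1 < -θ)), Real.zero_rpow (by linarith : -θ + 1 ≠ 0),
      sub_zero, show -θ + 1 = 1 - θ by ring]
  have hF0 : ∀ x, 0 ≤ F x := fun x =>
    mul_nonneg (Real.rpow_nonneg hK.le _) (Finset.prod_nonneg fun j _ => hg0 _)
  have hFi : Integrable F := by
    have : Integrable (fun x : Fin (n + 1) → ℝ => ∏ j, g (x j)) :=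
      Integrable.fintype_prod (f := fun _ => g) (μ := fun _ => volume) fun _ => hgi
    exact this.const_mul _
  have hFint : ∫ x, F x = K ^ θ * (L ^ (1 - θ) / (1 - θ)) ^ (n + 1) := by
    rw [hF]
    dsimp only
    rw [integral_const_mul, integral_fintype_prod_volume_eq_pow (fun t => g t), Fintype.card_fin,
      hgint]
  have hF1 : ∀ x ∈ V, 1 ≤ F x := by
    intro x hx
    obtain ⟨hxL, hxK⟩ := hx
    have hgx : ∀ j, g (x j) = x j ^ (-θ) := fun j => by
      rw [hg, Set.indicator_of_mem (show x j ∈ Ioc 0 L from ⟨(hxL j).1, (hxL j).2⟩)]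
    have hP : 0 < ∏ j, x j := Finset.prod_pos fun j _ => (hxL j).1
    rw [hF]
    dsimp only
    simp_rw [hgx]
    rw [Real.finsetProd_rpow _ _ (fun j _ => (hxL j).1.le), Real.rpow_neg hP.le,
      ← div_eq_mul_inv, ← Real.div_rpow hK.le hP.le]
    exact Real.one_le_rpow ((one_le_div hP).2 hxK) hθ0.le
  calc volume V = ∫⁻ x, V.indicator 1 x := (lintegral_indicator_one hVm).symm
    _ ≤ ∫⁻ x, ENNReal.ofReal (F x) := by
        refine lintegral_mono fun x => ?_
        by_cases hx : x ∈ V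
        · rw [Set.indicator_of_mem hx, Pi.one_apply]
          exact ENNReal.one_le_ofReal.2 (hF1 x hx)
        · rw [Set.indicator_of_notMem hx]
          exact bot_le
    _ = ENNReal.ofReal (∫ x, F x) :=
        (ofReal_integral_eq_lintegral_ofReal hFi (Eventually.of_forall hF0)).symm
    _ = _ := by rw [hFint]

/-- Bookkeeping of constants for the dyadic pieces. [folklore] -/
theorem piece_const_eq {C α θ t : ℝ} (hC : 0 < C) (ht : 0 < t)
    (hexp : -α * θ + (1 - θ) * ((n : ℝ) + 1) = -(α / 2)) :
    (C * t ^ (-α)) ^ θ * ((2 * t) ^ (1 - θ) / (1 - θ)) ^ (n + 1) =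
      C ^ θ * ((2 : ℝ) ^ (1 - θ) / (1 - θ)) ^ (n + 1) * t ^ (-(α / 2)) := by
  have h1 : (C * t ^ (-α)) ^ θ = C ^ θ * t ^ (-α * θ) := by
    rw [Real.mul_rpow hC.le (Real.rpow_nonneg ht.le _), ← Real.rpow_mul ht.le]
  have h2 : ((2 * t) ^ (1 - θ) / (1 - θ)) ^ (n + 1) =
      ((2 : ℝ) ^ (1 - θ) / (1 - θ)) ^ (n + 1) * t ^ ((1 - θ) * ((n : ℝ) + 1)) := by
    rw [Real.mul_rpow zero_le_two ht.le, Real.rpow_mul ht.le,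
      show ((n : ℝ) + 1) = ((n + 1 : ℕ) : ℝ) by push_cast; ring, Real.rpow_natCast, ← mul_pow]
    ring
  rw [h1, h2, ← hexp, Real.rpow_add ht]
  ring

open Literature.ModelTheory.ExponentialFields in
/-- **Polynomial tail decay for finite-volume semialgebraic down-sets.** Let `D ⊆ ℝ^{n+1}` be a
`ℚ`-semialgebraic subset of the open positive orthant which is a coordinatewise down-set
(`x ∈ D`, `0 < yᵢ ≤ xᵢ` for all `i` `⇒ y ∈ D`) of finite volume. Then
`vol(D ∖ B(0, R)) ≤ C R^{-a}` for all `R ≥ 1`, for some `C` and some `a > 0` (sup-norm balls).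
Proof: by `exists_prod_le_mul_rpow`, `∏ xᵢ ≤ C (max xᵢ)^{-α}` on `D` away from the unit cube;
a point of `D` outside `B(0, R)` has `2^k R ≤ max xᵢ < 2^{k+1} R` for some `k`, so lies in
`{y ∈ (0, 2^{k+1}R]^{n+1} | ∏ yⱼ ≤ C (2^k R)^{-α}}`, whose volume is `≤ K₁ (2^k R)^{-α/2}` by the
Markov-power bound with `θ = (n+1+α/2)/(n+1+α)`; sum the geometric series. This is the tail
estimate which, for general finite-volume semialgebraic sets, is a theorem of tame integration
theory (Lion–Rolin; Cluckers–Miller 2011, Prop. 1.5); for down-sets it is elementary. [folklore] -/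
theorem exists_volume_diff_ball_le (hD : IsSemialgebraic ℚ D) (hpos : ∀ x ∈ D, ∀ i, 0 < x i)
    (hdown : ∀ x ∈ D, ∀ y : Fin (n + 1) → ℝ, (∀ i, 0 < y i ∧ y i ≤ x i) → y ∈ D)
    (hfin : volume D ≠ ⊤) :
    ∃ C a : ℝ, 0 < a ∧ ∀ R : ℝ, 1 ≤ R →
      volume (D \ Metric.ball 0 R) ≤ ENNReal.ofReal (C * R ^ (-a)) := by
  obtain ⟨C, α, hC, hα, hbox⟩ := exists_prod_le_mul_rpow hD hpos hdown hfin
  set θ : ℝ := ((n : ℝ) + 1 + α / 2) / ((n : ℝ) + 1 + α) with hθ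
  have hθ0 : 0 < θ := by positivity
  have hθ1 : θ < 1 := by
    rw [hθ, div_lt_one (by positivity)]; linarith
  have hexp : -α * θ + (1 - θ) * ((n : ℝ) + 1) = -(α / 2) := by
    rw [hθ]; field_simp; ring
  set q : ℝ := (2 : ℝ) ^ (-(α / 2)) with hq
  have hq0 : 0 < q := Real.rpow_pos_of_pos two_pos _
  have hq1 : q < 1 := Real.rpow_lt_one_of_one_lt_of_neg one_lt_two (by linarith)
  set K₁ : ℝ := C ^ θ * ((2 : ℝ) ^ (1 - θ) / (1 - θ)) ^ (n + 1) with hK₁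
  have h1θ : 0 < 1 - θ := by linarith
  have hK₁0 : 0 ≤ K₁ := by positivity
  refine ⟨K₁ / (1 - q), α / 2, by linarith, fun R hR => ?_⟩
  have hR0 : 0 < R := by linarith
  -- the dyadic pieces
  set V : ℕ → Set (Fin (n + 1) → ℝ) := fun k =>
    {x | (∀ j, 0 < x j ∧ x j ≤ 2 * (2 ^ k * R)) ∧ ∏ j, x j ≤ C * (2 ^ k * R) ^ (-α)} with hV
  have hcover : D \ Metric.ball 0 R ⊆ ⋃ k, V k := by
    rintro x ⟨hxD, hxB⟩
    have hxpos := hpos x hxD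
    -- a coordinate `≥ R`
    have hi : ∃ i, R ≤ x i := by
      by_contra h
      push Not at h
      apply hxB
      rw [Metric.mem_ball, dist_zero_right, pi_norm_lt_iff hR0]
      intro i
      rw [Real.norm_eq_abs, abs_lt]
      exact ⟨by linarith [hxpos i], h i⟩
    obtain ⟨i, hi⟩ := hi
    have hs1 : R ≤ msup x := hi.trans (le_msup x i)
    have hs2 : 1 ≤ msup x / R := by rwa [le_div_iff₀ hR0, one_mul]
    obtain ⟨k, hk1, hk2⟩ := exists_nat_pow_near hs2 one_lt_two
    rw [le_div_iff₀ hR0] at hk1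
    rw [div_lt_iff₀ hR0, pow_succ] at hk2
    have ht : 0 < 2 ^ k * R := by positivity
    refine mem_iUnion.2 ⟨k, fun j => ⟨hxpos j, ?_⟩, ?_⟩
    · have := le_msup x j
      linarith
    · have h1 := hbox x hxD (hR.trans hs1)
      have h2 : msup x ^ (-α) ≤ (2 ^ k * R) ^ (-α) :=
        Real.rpow_le_rpow_of_nonpos ht hk1 (by linarith)
      exact h1.trans (mul_le_mul_of_nonneg_left h2 hC.le)
  have hpiece : ∀ k, volume (V k) ≤ ENNReal.ofReal (K₁ * R ^ (-(α / 2)) * q ^ k) := by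
    intro k
    have ht : 0 < 2 ^ k * R := by positivity
    have h1 := volume_prodLe_le (n := n) (L := 2 * (2 ^ k * R)) (K := C * (2 ^ k * R) ^ (-α))
      (by positivity) (mul_pos hC (Real.rpow_pos_of_pos ht _)) hθ0 hθ1
    refine h1.trans (le_of_eq ?_)
    congr 1
    rw [piece_const_eq hC ht hexp, ← hK₁, Real.mul_rpow (by positivity) hR0.le, hq,
      ← Real.rpow_natCast ((2 : ℝ) ^ (-(α / 2))) k, ← Real.rpow_mul zero_le_two,
      ← Real.rpow_natCast (2 : ℝ) k, ← Real.rpow_mul zero_le_two]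
    ring_nf
  have hsum : Summable fun k : ℕ => K₁ * R ^ (-(α / 2)) * q ^ k :=
    (summable_geometric_of_lt_one hq0.le hq1).mul_left _
  have hnn : ∀ k : ℕ, 0 ≤ K₁ * R ^ (-(α / 2)) * q ^ k := fun k =>
    mul_nonneg (mul_nonneg hK₁0 (Real.rpow_nonneg hR0.le _)) (pow_nonneg hq0.le _)
  calc volume (D \ Metric.ball 0 R) ≤ volume (⋃ k, V k) := measure_mono hcover
    _ ≤ ∑' k, volume (V k) := measure_iUnion_le _
    _ ≤ ∑' k, ENNReal.ofReal (K₁ * R ^ (-(α / 2)) * q ^ k) := ENNReal.tsum_le_tsum hpiece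
    _ = ENNReal.ofReal (∑' k, K₁ * R ^ (-(α / 2)) * q ^ k) :=
        (ENNReal.ofReal_tsum_of_nonneg hnn hsum).symm
    _ = ENNReal.ofReal (K₁ / (1 - q) * R ^ (-(α / 2))) := by
        rw [tsum_mul_left, tsum_geometric_of_lt_one hq0.le hq1]
        congr 1
        field_simp

end DownSet

end DownSetTail

end Literature.NumberTheory.Transcendental
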